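import Literature.MathematicalPhysics.QuantumFieldTheory.Balaban1983to89.B14Eq316
import Literature.MathematicalPhysics.QuantumFieldTheory.Balaban1983to89.B14Eq123Localization

/-!
# `Balaban1983to89.B14Eq113Fluctuation` — CMP 119 (1.13) p. 248: the fluctuation field `A′ = (1/i) log U′`,
# `U′ = U U₁⁻¹`, and the sentence *"The field U′ is small, because U′ = UU₁⁻¹ = (UU₁,h⁻¹)(U₁,h U₁⁻¹) and both fields
# … are small"* — PROVED for the tree's `(1/i) log(V W⁻¹)` = `B14.Eq316.bH`

statement-level skeleton of published theorems with citation tags; proofs where landed; nothing here is a claim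
about the Yang–Mills mass gap.

CITATION HEADER (lean-in-tree rule).  Source: T. Bałaban, *Convergent renormalization expansions for lattice gauge
theories*, Commun. Math. Phys. **119**, 243–285 (1988), doi:10.1007/bf01217741 [Balaban1988Convergent] (cell paper
B14 = "[III]"; held `paper:balaban1988-cmp119-convergent-renormalization`, journal page = PDF page + 242; p. 248 read
on the x2 render `…-p006-x2.png` and the text layer).  Mega-formalization `lit-balaban`, unit `lit-balaban-r11`
(CMP 119), SKELETON row **B14.Eq1.13** (the logarithm is pre-cell `MatrixLog.mlog`; the printed shape
`(1/i) log(V W⁻¹)` is r11 gen 2 `B14.Eq316.bH`, p243442, typed there for (3.22) — the step-`k` twin of (1.13)).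

THE PRINTED TEXT (p. 248, verbatim): *"The field U′ is small, because U′ = UU₁⁻¹ = (UU⁻¹_{1,h})(U_{1,h}U₁⁻¹), and both
fields in the parenthesis on the right-hand side of this equality are small. We denote
  A′ = (1/i) log U′,  or  U′ = exp iA′,   (1.13)
and we call A′ a fluctuation field."*  (`U` the new field of (1.11), `U₁ = U₁(Ω₁, V)` the minimizer of (1.12) —
[15] Theorem 1, row B11.Thm1 —, `U_{1,h}` the configuration of the restrictions (1.3).)

WHAT IS PROVED.  The model: bond variables with values in the units `𝔸ˣ` of a complete normed `ℂ`-algebra `𝔸 ⊇ G`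
(print's `G ⊂ U(n) ⊂ (M_n(ℂ))ˣ` is the instance), bondwise.  (1.13)'s `A′` IS the tree's `B14.Eq316.bH U U₁ =
(1/i)·mlog(U U₁⁻¹)` (definiens verbatim; `log` = the series (21) of [Balaban1985Averaging], `MatrixLog.mlog`), and
*"U′ = exp iA′"* is `B14.Eq316.exp_I_smul_bH` on the convergence disc `‖U′ − 1‖ < 1`.  NEW here, the sentence print
ARGUES: §1 `‖XY − 1‖ ≤ ‖X − 1‖‖Y − 1‖ + ‖X − 1‖ + ‖Y − 1‖` (the tree's `B14Eq123Localization.norm_mul_sub_one_le`,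
p28, reused) and the factorisation
`U U₁⁻¹ = (U U_{1,h}⁻¹)(U_{1,h} U₁⁻¹)` (`fluct_factor`) give `‖U′ − 1‖ ≤ δ² + 2δ` when both factors are within `δ` of `1`
(`norm_Uprime_sub_one_le_of_le`) — *"both fields … are small"* ⇒ *"U′ is small"*; §2 hence (1.13) holds —
`exp(iA′) = U′` — as soon as `δ² + 2δ < 1` (`eq113_of_small`), and the fluctuation field itself is small,
`‖A′‖ ≤ 2(δ² + 2δ)` for `δ² + 2δ ≤ ½` (`norm_fluct_le_of_small`, from `B14.Eq316.norm_bH_le`).  SCOPE: which `δ` —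
print's "small" is (1.3) for `U U_{1,h}⁻¹` (`ε₀`-regularity, row B14.Eq1.3) and [15] (29)/(190) for `U_{1,h}U₁⁻¹`
(row B11.Thm1, typed) — enters as the two hypotheses; no separate `def` for `A′` (the definiens `bH U U₁` is the named
decl; G.5-44 hygiene welcome, not owed).  Theorems only; no `sorry`.
-/

noncomputable section

namespace Literature.MathematicalPhysics.QuantumFieldTheory.Balaban1983to89.B14.Eq113Fluctuation

open NormedSpace
open Literature.MathematicalPhysics.QuantumFieldTheory.Balaban1983to89 MatrixLog B14.Eq316

variable {𝔸 : Type*} [NormedRing 𝔸]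

/-! ## §1  "both fields … are small" ⇒ "U′ is small" -/

/- The algebra behind p. 248's sentence — `XY − 1 = (X − 1)(Y − 1) + (X − 1) + (Y − 1)`, hence
`‖XY − 1‖ ≤ ‖X − 1‖·‖Y − 1‖ + ‖X − 1‖ + ‖Y − 1‖` — is already in the tree (p28's `B14Eq123Localization.norm_mul_sub_one_le`,
the same bookkeeping for (1.23)); it is REUSED by name below. -/

/-- *"U′ = UU₁⁻¹ = (UU⁻¹_{1,h})(U_{1,h}U₁⁻¹)"* — the factorisation through the configuration `U_{1,h}` of (1.3), in the
group of units. [cite: Balaban1988Convergent, (1.13) p.248] -/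
theorem fluct_factor (U U₁ U₁h : 𝔸ˣ) : U * U₁⁻¹ = (U * U₁h⁻¹) * (U₁h * U₁⁻¹) := by
  rw [mul_assoc, inv_mul_cancel_left]

/-- *"The field U′ is small, because … both fields … are small"*, quantitatively:
`‖U′ − 1‖ ≤ ‖UU_{1,h}⁻¹ − 1‖·‖U_{1,h}U₁⁻¹ − 1‖ + ‖UU_{1,h}⁻¹ − 1‖ + ‖U_{1,h}U₁⁻¹ − 1‖`.
[cite: Balaban1988Convergent, (1.13) p.248] -/
theorem norm_Uprime_sub_one_le (U U₁ U₁h : 𝔸ˣ) :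
    ‖((U * U₁⁻¹ : 𝔸ˣ) : 𝔸) - 1‖ ≤ ‖((U * U₁h⁻¹ : 𝔸ˣ) : 𝔸) - 1‖ * ‖((U₁h * U₁⁻¹ : 𝔸ˣ) : 𝔸) - 1‖
      + ‖((U * U₁h⁻¹ : 𝔸ˣ) : 𝔸) - 1‖ + ‖((U₁h * U₁⁻¹ : 𝔸ˣ) : 𝔸) - 1‖ := by
  rw [fluct_factor U U₁ U₁h, Units.val_mul]
  exact B14Eq123Localization.norm_mul_sub_one_le _ _

/-- With both factors within `δ` of `1`: `‖U′ − 1‖ ≤ δ² + 2δ`. [cite: Balaban1988Convergent, (1.13) p.248] -/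
theorem norm_Uprime_sub_one_le_of_le (U U₁ U₁h : 𝔸ˣ) {δ : ℝ} (hX : ‖((U * U₁h⁻¹ : 𝔸ˣ) : 𝔸) - 1‖ ≤ δ)
    (hY : ‖((U₁h * U₁⁻¹ : 𝔸ˣ) : 𝔸) - 1‖ ≤ δ) : ‖((U * U₁⁻¹ : 𝔸ˣ) : 𝔸) - 1‖ ≤ δ ^ 2 + 2 * δ := by
  have hδ0 : 0 ≤ δ := (norm_nonneg _).trans hX
  calc ‖((U * U₁⁻¹ : 𝔸ˣ) : 𝔸) - 1‖ ≤ _ := norm_Uprime_sub_one_le U U₁ U₁h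
    _ ≤ δ * δ + δ + δ := by gcongr
    _ = δ ^ 2 + 2 * δ := by ring

/-! ## §2  (1.13): `U′ = exp iA′` with `A′ = (1/i) log U′ = B14.Eq316.bH U U₁`, and `A′` is small -/

variable [NormedAlgebra ℂ 𝔸] [CompleteSpace 𝔸]

/-- **(1.13)** *"A′ = (1/i) log U′, or U′ = exp iA′"* for `A′ := B14.Eq316.bH U U₁ = (1/i)·log(UU₁⁻¹)`, under print's
two smallness inputs (both factors within `δ` of `1`, `δ² + 2δ < 1`, e.g. `δ ≤ 2/5`): `exp(iA′) = UU₁⁻¹`.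
[cite: Balaban1988Convergent, (1.13) p.248] -/
theorem eq113_of_small (U U₁ U₁h : 𝔸ˣ) {δ : ℝ} (hX : ‖((U * U₁h⁻¹ : 𝔸ˣ) : 𝔸) - 1‖ ≤ δ)
    (hY : ‖((U₁h * U₁⁻¹ : 𝔸ˣ) : 𝔸) - 1‖ ≤ δ) (hδ : δ ^ 2 + 2 * δ < 1) :
    exp ((Complex.I : ℂ) • bH U U₁) = ((U * U₁⁻¹ : 𝔸ˣ) : 𝔸) :=
  exp_I_smul_bH U U₁ ((norm_Uprime_sub_one_le_of_le U U₁ U₁h hX hY).trans_lt hδ)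

/-- **The fluctuation field is small**: `‖A′‖ ≤ 2‖U′ − 1‖ ≤ 2(δ² + 2δ)` when `δ² + 2δ ≤ ½` (e.g. `δ ≤ 1/5`).
[cite: Balaban1988Convergent, (1.13) p.248] -/
theorem norm_fluct_le_of_small (U U₁ U₁h : 𝔸ˣ) {δ : ℝ} (hX : ‖((U * U₁h⁻¹ : 𝔸ˣ) : 𝔸) - 1‖ ≤ δ)
    (hY : ‖((U₁h * U₁⁻¹ : 𝔸ˣ) : 𝔸) - 1‖ ≤ δ) (hδ : δ ^ 2 + 2 * δ ≤ 1 / 2) :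
    ‖bH U U₁‖ ≤ 2 * (δ ^ 2 + 2 * δ) := by
  have h := norm_Uprime_sub_one_le_of_le U U₁ U₁h hX hY
  exact (norm_bH_le U U₁ (h.trans hδ)).trans (by linarith)

/-- `δ ≤ 1/5` suffices for both: `δ² + 2δ ≤ ½ < 1`. [cite: Balaban1988Convergent, (1.13) p.248] -/
theorem sq_add_two_mul_le_half {δ : ℝ} (h0 : 0 ≤ δ) (h : δ ≤ 1 / 5) : δ ^ 2 + 2 * δ ≤ 1 / 2 := by
  nlinarith

end Literature.MathematicalPhysics.QuantumFieldTheory.Balaban1983to89.B14.Eq113Fluctuation
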